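import Summits.FinalStateConjecture.FinalStateConjecture.Theorems.DrainImpliesDisperse.Negative.DrainImpliesDisperseFalseOfFramedAxisPulses
import Summits.FinalStateConjecture.FinalStateConjecture.Theorems.BondiDrainDispersalDrainImpliesDisperseReduction
import HarnessLib

/-!
# Crux `DrainImpliesDisperse` (stmt-FinalStateConjecture-17283), line `registered`, reshape r3:
# the ROUGH engine stub `stub_radiativeEnd_rough` is false on a framed pulsed development of a rough datum

Reshape r3 of the skeleton (`Cruxes/DrainImpliesDisperse/Lines/birth.lean`, lead c5) splits the engine stub
by the regularity of the datum: `stub_radiativeEnd_CK` (CK-class data; the plausible open core) and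
`stub_radiativeEnd_rough` (admissible data NOT CK-strongly asymptotically flat on any sole end; suspect-false,
the regularity channel of REPORT-c3). This file certifies the second half of that claim in the negative-modulo
lane, independently of the open `stub_radiativeEnd_CK`:

* `not_settlesT2_of_pulsedObserver` — the LOCAL form of the negative lemma
  `drainImpliesDisperse_false_of_pulsedObserver` (p155615): a development carrying a persistently pulsed,
  ray-borne, all-seeing future timelike observer, whose asymptotically flat entire late charts into `J⁺(ι X)`
  have eventually achronal slabs, admits NO honest `N = 0` decomposition (same proof, with the crux's
  conclusion for this one development as the refuted statement);
* `RoughFramedAxisPulsesDevelopmentExists` — `FramedAxisPulsesDevelopmentExists` (p162717: drained censored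
  MGHD with a global near-Minkowski frame whose time axis is ray-borne and recurrently pulsed) for a datum
  which is NOT CK on any sole end (c3's witnesses `ε r⁻¹⁰ sin(r⁴)` are of this kind: `∂³h ≍ r⁻¹`);
* `stub_radiativeEnd_rough_false_of_roughFramedAxisPulsesDevelopmentExists` — on that development the rough
  stub would supply a horizonless radiative end, hence (landed reduction `settles_of_horizonlessRadiativeEnd`,
  p149007) an honest `N = 0` decomposition, contradicting `not_settlesT2_of_pulsedObserver` (achronality of
  late slabs from the frame: `eventually_isClosed_image_of_frame` + `eventually_isAchronal_of_eventually_proper`;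
  (T), (V) from the axis theorems).

So, modulo the construction, the falsity of the crux as filed lives in `stub_radiativeEnd_rough` alone. Line lead
`prover-line-stmt-FinalStateConjecture-17283-c5-0`, 2026-08-17.
-/

noncomputable section

set_option linter.dupNamespace false -- D-0017: `Summit.<S>.<S>.…` by design

open Set Filter Function TopologicalSpace Topology
open scoped Manifold ContDiff Topology

namespace Summit.FinalStateConjecture.FinalStateConjecture.Theorems.DrainImpliesDisperse.Negative

open Literature.Geometry.Lorentzian
open Summit.FinalStateConjecture (HasCompleteNullInfinity exteriorOf RaysStayInClosure HasExhaustiveCharts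
  IsFutureOriented certifiedLate certifiedSlab)
open Summit.FinalStateConjecture.FinalStateConjecture.Theses.BondiDrainDispersal (DrainImpliesDisperse)

/-- `1 ≤ ∞` in `ℕ∞ω` (regularity side condition of the push-up lemma). [folklore] -/
private lemma one_le_infty' : (1 : ℕ∞ω) ≤ ((⊤ : ℕ∞) : ℕ∞ω) := WithTop.coe_le_coe.mpr le_top

section Development

/-- **No honest `N = 0` decomposition on a development with a persistently pulsed observer** (local
form of `drainImpliesDisperse_false_of_pulsedObserver`, p155615, same proof): given a future timelike curve
`c` on `[0, ∞)` which is (R) ray-borne, (V) all-seeing on `J⁺(ι X)` and (W) recurrently not `δ`-quiet in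
`C²` in any local flat chart, `0 < δ`, in a development whose entire `C²`-asymptotically flat eventually
future-oriented late charts into `J⁺(ι X)` have eventually achronal slabs (A), there are no `O` and
`C²` final-state decomposition `d` with `d.N = 0`, `O = exteriorOf 𝒟 d.charted`, `RaysStayInClosure`,
`HasExhaustiveCharts`, `IsFutureOriented`. [cite: ONeillSemiRiemannian1983, Ch. 14, Cor. 14.1 (p. 402)] -/
theorem not_settlesT2_of_pulsedObserver (X : Type) [TopologicalSpace X]
    [ChartedSpace E3 X] [IsManifold (𝓡 3) ∞ X]
    [ConnectedSpace X] (D : InitialDataSet (𝓡 3) X)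
    (𝒟 : VacuumCauchyDevelopment D)
    (c : ℝ → 𝒟.carrier) (δ : ENNReal) (hδ : 0 < δ)
    (hc : 𝒟.metric.IsFutureTimelikeCurveOn 𝒟.timeOrientation c (Ici 0))
    (hray : ∀ [𝒟.metric.HasLeviCivita], ∀ s : ℝ, 0 ≤ s →
      ∃ (p : X) (γ : ℝ → 𝒟.carrier) (dom : Set ℝ) (t : ℝ),
        𝒟.metric.IsNormalisedNullRayFrom 𝒟.timeOrientation 𝒟.embed 𝒟.normal p γ dom ∧
          ¬ BddAbove dom ∧ t ∈ dom ∧ 0 ≤ t ∧ γ t = c s)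
    (hvis : ∀ a ∈ 𝒟.metric.causalFuture 𝒟.timeOrientation (range 𝒟.embed),
      ∃ s : ℝ, 0 ≤ s ∧ c s ∈ 𝒟.metric.chronologicalFuture 𝒟.timeOrientation {a})
    (hwild : ∀ s₀ : ℝ, ∃ s : ℝ, s₀ < s ∧
      ∀ (U : Opens E4) (Φ : (Minkowski.backgroundOn U).domain → 𝒟.carrier)
        (V : Set (Minkowski.backgroundOn U).domain) (x : (Minkowski.backgroundOn U).domain),
        IsOpen V → x ∈ V → ContMDiff 𝓘(ℝ, E4) (𝓡 4) ∞ Φ → IsOpenEmbedding (V.restrict Φ) →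
        Φ x = c s →
        δ ≤ supCkENorm {(x : E4)} 2 (𝒟.toSpacetime.deviationExtend (Minkowski.backgroundOn U) Φ))
    (hach : ∀ (U : Opens E4) (τ₀ : ℝ) (Φ : (Minkowski.backgroundOn U).domain → 𝒟.carrier),
      Minkowski.lateRegion τ₀ ⊆ (U : Set E4) →
      𝒟.toSpacetime.IsLateChart (Minkowski.backgroundOn U)
        (𝒟.metric.causalFuture 𝒟.timeOrientation (range 𝒟.embed)) τ₀ Φ →
      Tendsto (fun τ ↦ 𝒟.toSpacetime.deviationCk (Minkowski.backgroundOn U) Φ 2 τ) atTop (𝓝 0) →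
      (∀ᶠ τ in atTop, ∀ x ∈ (Minkowski.backgroundOn U).timeSlab τ,
        𝒟.timeOrientation.IsFutureDirected (mfderiv 𝓘(ℝ, E4) (𝓡 4) Φ x (E4.basisVector 0))) →
      ∀ᶠ τ in atTop, 𝒟.metric.IsAchronal 𝒟.timeOrientation
        (Φ '' (Minkowski.backgroundOn U).timeSlab τ)) :
    ¬ ∃ (O : Set 𝒟.carrier) (d : FinalStateDecomposition 𝒟.toSpacetime O 2),
        d.N = 0 ∧ O = exteriorOf 𝒟.toCauchyDevelopment d.charted ∧
          RaysStayInClosure 𝒟.toCauchyDevelopment O ∧ HasExhaustiveCharts d ∧ IsFutureOriented d := by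
  rintro ⟨O, d, hN, hO, hrays, hexh, hfut⟩
  have hlate : 𝒟.toSpacetime.IsLateChart (Minkowski.backgroundOn d.flatDomain) O d.τ₀ d.flatChart :=
    d.isLateChart_flat
  have hOJ : O ⊆ 𝒟.metric.causalFuture 𝒟.timeOrientation (range 𝒟.embed) := by
    rw [hO]
    exact inter_subset_left
  -- (A): the flat chart's slabs are eventually achronal
  have hA : ∀ᶠ τ in atTop, 𝒟.metric.IsAchronal 𝒟.timeOrientation
      (d.flatChart '' (Minkowski.backgroundOn d.flatDomain).timeSlab τ) :=
    hach d.flatDomain d.τ₀ d.flatChart (d.lateRegion_subset_flatDomain_of_N_eq_zero hN)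
      ⟨hlate.contMDiff, hlate.isOpenEmbedding, hlate.image_subset.trans hOJ⟩
      d.tendsto_deviationCk_flat hfut.2.2
  -- eventually the `C²` deviation on entire flat slabs is `< δ`
  have hdev : ∀ᶠ τ in atTop,
      𝒟.toSpacetime.deviationCk (Minkowski.backgroundOn d.flatDomain) d.flatChart 2 τ < δ :=
    (tendsto_order.1 d.tendsto_deviationCk_flat).2 δ hδ
  obtain ⟨T, hT⟩ := eventually_atTop.1 (hA.and hdev)
  -- a late chart time `τ₁ > τ₀`, `τ₁ ≥ T`
  obtain ⟨τ₁, hτ₁T, hτ₁0⟩ : ∃ τ₁ : ℝ, T ≤ τ₁ ∧ d.τ₀ < τ₁ :=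
    ⟨max T (d.τ₀ + 1), le_max_left _ _, (lt_add_one _).trans_le (le_max_right _ _)⟩
  have hachr := (hT τ₁ hτ₁T).1
  -- the slab point `a₀ = Ψ (τ₁, 0, 0, 0)`
  have hz0 : (τ₁ • E4.basisVector 0 : E4) 0 = τ₁ := by simp
  have hzU : (τ₁ • E4.basisVector 0 : E4) ∈ (d.flatDomain : Set E4) :=
    d.lateRegion_subset_flatDomain_of_N_eq_zero hN
      (show d.τ₀ < (τ₁ • E4.basisVector 0 : E4) 0 by rw [hz0]; exact hτ₁0)
  let x₀ : (Minkowski.backgroundOn d.flatDomain).domain := ⟨τ₁ • E4.basisVector 0, hzU⟩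
  have hx₀slab : x₀ ∈ (Minkowski.backgroundOn d.flatDomain).timeSlab τ₁ :=
    show (τ₁ • E4.basisVector 0 : E4) 0 = τ₁ from hz0
  have hx₀late : x₀ ∈ (Minkowski.backgroundOn d.flatDomain).lateRegion d.τ₀ :=
    show d.τ₀ < (τ₁ • E4.basisVector 0 : E4) 0 by rw [hz0]; exact hτ₁0
  have ha₀O : d.flatChart x₀ ∈ O := hlate.image_subset (mem_image_of_mem d.flatChart hx₀late)
  -- the observer sees `a₀`; a later pulse event `c s ≫ a₀`
  obtain ⟨s₀, hs₀, hvis₀⟩ := hvis (d.flatChart x₀) (hOJ ha₀O)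
  obtain ⟨s, hs₀s, hws⟩ := hwild s₀
  have hs : 0 ≤ s := hs₀.trans hs₀s.le
  have hcs : c s ∈ 𝒟.metric.chronologicalFuture 𝒟.timeOrientation {d.flatChart x₀} :=
    LorentzianMetric.mem_chronologicalFuture_trans hvis₀
      (mem_chronologicalFuture_of_timelikeCurve hs₀s
        (hc.mono fun r hr ↦ mem_Ici.mpr (hs₀.trans hr.1)))
  -- `c s ∈ O`, hence in the flat chart's late region after `τ₁`
  have hcsO : c s ∈ O := worldline_mem_exteriorOf 𝒟.toCauchyDevelopment hO hrays hc hray hs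
  have hcsL : c s ∈ d.flatChart '' (Minkowski.backgroundOn d.flatDomain).lateRegion τ₁ := by
    by_contra hnot
    exact not_mem_causalPast_of_isAchronal one_le_infty' hachr (mem_image_of_mem d.flatChart hx₀slab)
      hcs (diff_lateRegion_subset_causalPast_slab_of_N_eq_zero d hN hexh hτ₁0 ⟨hcsO, hnot⟩)
  obtain ⟨x, hxlate, hxcs⟩ := hcsL
  have hxlate' : τ₁ < (x : E4) 0 := hxlate
  -- (W) at `c s = Ψ x` against `deviationCk … 2 (x⁰) < δ`
  have hopen : IsOpen ((Minkowski.backgroundOn d.flatDomain).lateRegion d.τ₀) := by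
    have hc0 : Continuous fun y : E4 ↦ y 0 := PiLp.continuous_apply 2 _ 0
    exact isOpen_lt continuous_const (hc0.comp continuous_subtype_val)
  have hxlate0 : x ∈ (Minkowski.backgroundOn d.flatDomain).lateRegion d.τ₀ :=
    (Minkowski.backgroundOn d.flatDomain).lateRegion_mono hτ₁0.le hxlate
  have hle := hws d.flatDomain d.flatChart ((Minkowski.backgroundOn d.flatDomain).lateRegion d.τ₀) x
    hopen hxlate0 hlate.contMDiff hlate.isOpenEmbedding hxcs
  have hxslab : (x : E4) ∈
      Subtype.val '' (Minkowski.backgroundOn d.flatDomain).timeSlab ((x : E4) 0) := ⟨x, rfl, rfl⟩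
  have hmono : supCkENorm {(x : E4)} 2
      (𝒟.toSpacetime.deviationExtend (Minkowski.backgroundOn d.flatDomain) d.flatChart) ≤
      𝒟.toSpacetime.deviationCk (Minkowski.backgroundOn d.flatDomain) d.flatChart 2 ((x : E4) 0) :=
    supCkENorm_mono (singleton_subset_iff.mpr hxslab) 2 _
  have hlt : 𝒟.toSpacetime.deviationCk (Minkowski.backgroundOn d.flatDomain) d.flatChart 2
      ((x : E4) 0) < δ :=
    (hT ((x : E4) 0) (hτ₁T.trans hxlate'.le)).2
  exact absurd (hle.trans hmono) (not_le.mpr hlt)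


end Development

/-- **Construction hypothesis (rough framed axis form)**: `FramedAxisPulsesDevelopmentExists` for a datum
which is NOT Christodoulou–Klainerman strongly asymptotically flat on any sole end — the regularity
channel's witnesses (`δ + ε r⁻¹⁰ sin(r⁴) w₀`: admissible, `∂³h ≍ r⁻¹`) are of this kind
(`Cruxes/DrainImpliesDisperse/REPORT-c3.md` §§2–3). Not constructible in the tree (no maximal development
of a non-flat admissible datum). Construction hypothesis of a negative lemma, not a published fact (no
citation tag). -/
def RoughFramedAxisPulsesDevelopmentExists : Prop :=
  ∃ (X : Type) (_ : TopologicalSpace X) (_ : ChartedSpace E3 X) (_ : IsManifold (𝓡 3) ∞ X)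
    (_ : T2Space X) (_ : SecondCountableTopology X) (_ : ConnectedSpace X)
    (D : InitialDataSet (𝓡 3) X) (_ : D ∈ admissibleVacuumData X)
    (_ : ¬ ∃ (e : AFEnd X) (M : ℝ), e.IsSoleEnd ∧ e.IsStronglyAsymptoticallyFlatCK D M)
    (𝒟 : VacuumCauchyDevelopment D)
    (_ : 𝒟.IsMaximal) (_ : HasCompleteNullInfinity 𝒟.toCauchyDevelopment)
    (_ : 𝒟.toCauchyDevelopment.HasVanishingFinalBondiMass)
    (Θ : Minkowski.background.domain → 𝒟.carrier) (Ξ : 𝒟.carrier → E4) (δ : ENNReal),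
    ContMDiff 𝓘(ℝ, E4) (𝓡 4) ∞ Θ ∧ ContMDiff (𝓡 4) 𝓘(ℝ, E4) ∞ Ξ ∧
    (∀ p, Θ ⟨Ξ p, Opens.mem_top _⟩ = p) ∧
    (∀ x, ‖𝒟.toSpacetime.deviation Minkowski.background Θ x‖ < 1 / 4) ∧
    (∀ x, 𝒟.timeOrientation.IsFutureDirected (mfderiv 𝓘(ℝ, E4) (𝓡 4) Θ x (E4.basisVector 0))) ∧
    (∀ a ∈ 𝒟.metric.causalFuture 𝒟.timeOrientation (range 𝒟.embed), 0 ≤ E4.time (Ξ a)) ∧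
    0 < δ ∧
    (∀ [𝒟.metric.HasLeviCivita], ∀ s : ℝ, 0 ≤ s →
      ∃ (p : X) (γ : ℝ → 𝒟.carrier) (dom : Set ℝ) (t : ℝ),
        𝒟.metric.IsNormalisedNullRayFrom 𝒟.timeOrientation 𝒟.embed 𝒟.normal p γ dom ∧
          ¬ BddAbove dom ∧ t ∈ dom ∧ 0 ≤ t ∧ γ t = Θ ⟨s • E4.basisVector 0, trivial⟩) ∧
    (∀ s₀ : ℝ, ∃ s : ℝ, s₀ < s ∧
      ∀ (U : Opens E4) (Φ : (Minkowski.backgroundOn U).domain → 𝒟.carrier)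
        (V : Set (Minkowski.backgroundOn U).domain) (x : (Minkowski.backgroundOn U).domain),
        IsOpen V → x ∈ V → ContMDiff 𝓘(ℝ, E4) (𝓡 4) ∞ Φ → IsOpenEmbedding (V.restrict Φ) →
        Φ x = Θ ⟨s • E4.basisVector 0, trivial⟩ →
        δ ≤ supCkENorm {(x : E4)} 2 (𝒟.toSpacetime.deviationExtend (Minkowski.backgroundOn U) Φ))

/-- **The rough engine stub is false on a rough framed pulsed development.** If
`RoughFramedAxisPulsesDevelopmentExists`, then the registered stub `stub_radiativeEnd_rough` of line
`registered` (reshape r3: a horizonless radiative end (E1)–(E6) for every censored drained MGHD of every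
admissible datum that is NOT CK on any sole end) fails: on the witness development it would give, through
the landed reduction `settles_of_horizonlessRadiativeEnd` (p149007), an honest `N = 0` decomposition,
against `not_settlesT2_of_pulsedObserver` with the frame's axis as observer ((T), (V) by the axis theorems,
(A) by `eventually_isClosed_image_of_frame` and `eventually_isAchronal_of_eventually_proper`). The negated
statement is the registered stub signature verbatim. [folklore] -/
theorem stub_radiativeEnd_rough_false_of_roughFramedAxisPulsesDevelopmentExists
    (H : RoughFramedAxisPulsesDevelopmentExists) :
    ¬ (  ∀ (X : Type) [TopologicalSpace X] [ChartedSpace E3 X] [IsManifold (𝓡 3) ∞ X] [T2Space X]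
    [SecondCountableTopology X] [ConnectedSpace X],
    ∀ D ∈ admissibleVacuumData X,
      ¬ (∃ (e : AFEnd X) (M : ℝ), e.IsSoleEnd ∧ e.IsStronglyAsymptoticallyFlatCK D M) →
      ∀ 𝒟 : VacuumCauchyDevelopment D, 𝒟.IsMaximal →
      Summit.FinalStateConjecture.HasCompleteNullInfinity 𝒟.toCauchyDevelopment →
      𝒟.toCauchyDevelopment.HasVanishingFinalBondiMass →
      ∃ (τ₀ : ℝ) (Ψ : Minkowski.background.domain → 𝒟.carrier),
        ContMDiff 𝓘(ℝ, E4) (𝓡 4) ∞ Ψ ∧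
        IsOpenEmbedding ((Minkowski.background.lateRegion τ₀).restrict Ψ) ∧
        IsClosed (Ψ '' {x : Minkowski.background.domain | τ₀ ≤ x.1 0}) ∧
        Ψ '' Minkowski.background.lateRegion τ₀ ⊆
          𝒟.metric.causalFuture 𝒟.timeOrientation (range 𝒟.embed) ∧
        (∀ x : Minkowski.background.domain, τ₀ ≤ x.1 0 →
          𝒟.metric.IsTimelike (mfderiv 𝓘(ℝ, E4) (𝓡 4) Ψ x (E4.basisVector 0)) ∧
          𝒟.timeOrientation.IsFutureDirected (mfderiv 𝓘(ℝ, E4) (𝓡 4) Ψ x (E4.basisVector 0))) ∧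
        Tendsto (fun τ ↦ 𝒟.toSpacetime.deviationCk Minkowski.background Ψ 2 τ) atTop (𝓝 0) ∧
        𝒟.metric.causalFuture 𝒟.timeOrientation (range 𝒟.embed) ⊆
          𝒟.metric.chronologicalPast 𝒟.timeOrientation (Ψ '' Minkowski.background.lateRegion τ₀)) := by
  intro hstub
  obtain ⟨X, _, _, _, _, _, _, D, hD, hrough, 𝒟, hmax, hcni, hdrain, Θ, Ξ, δ, hΘ, hΞ, hΘΞ, hpinΘ, hfutΘ,
    hfloor, hδ, hray, hwild⟩ := H
  -- the rough stub's radiative end and the honest `N = 0` decomposition it carries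
  obtain ⟨τ₀, Ψ, hsm, hemb, hcl, hJ, hT, hdec, hE6⟩ := hstub X D hD hrough 𝒟 hmax hcni hdrain
  have hsettles := settles_of_horizonlessRadiativeEnd X D 𝒟.toCauchyDevelopment τ₀ Ψ hsm hemb hcl hJ hT
    hdec hE6
  -- the axis observer and the achronality of late slabs in the frame
  refine not_settlesT2_of_pulsedObserver X D 𝒟 (fun s : ℝ ↦ Θ ⟨s • E4.basisVector 0, trivial⟩) δ hδ
    (isFutureTimelikeCurveOn_axis 𝒟.toSpacetime Θ hΘ hpinΘ hfutΘ (Ici 0)) hray ?_ hwild ?_ hsettles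
  · intro a ha
    refine ⟨E4.time (Ξ a) + 2 * ‖E4.spatial (Ξ a)‖ + 1, ?_,
      axis_mem_chronologicalFuture 𝒟.toSpacetime Θ Ξ hΘ hΘΞ hpinΘ hfutΘ a⟩
    have h := hfloor a ha
    positivity
  · intro U τ₀' Φ hU hlate hdec' hfut
    exact eventually_isAchronal_of_eventually_proper 𝒟.toSpacetime U τ₀' Φ _ hlate hdec' hfut
      (eventually_isClosed_image_of_frame 𝒟.toSpacetime Θ Ξ hΘ hΞ hΘΞ hpinΘ hfutΘ _ hfloor U τ₀' Φ hU
        hlate hdec' hfut)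

/-- Forgetting the roughness clause: `RoughFramedAxisPulsesDevelopmentExists → FramedAxisPulsesDevelopmentExists`.
[folklore] -/
theorem framedAxisPulsesDevelopmentExists_of_rough (H : RoughFramedAxisPulsesDevelopmentExists) :
    FramedAxisPulsesDevelopmentExists := by
  obtain ⟨X, _, _, _, _, _, _, D, hD, -, 𝒟, hmax, hcni, hdrain, Θ, Ξ, δ, hrest⟩ := H
  exact ⟨X, inferInstance, inferInstance, inferInstance, inferInstance, inferInstance, inferInstance, D, hD,
    𝒟, hmax, hcni, hdrain, Θ, Ξ, δ, hrest⟩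

/-- **Negative lemma modulo `RoughFramedAxisPulsesDevelopmentExists`**: the crux as filed fails on a rough
framed pulsed development (through `DrainImpliesDisperse_false_of_framedAxisPulsesDevelopmentExists`).
[folklore] -/
theorem DrainImpliesDisperse_false_of_roughFramedAxisPulsesDevelopmentExists
    (H : RoughFramedAxisPulsesDevelopmentExists) : ¬ DrainImpliesDisperse :=
  DrainImpliesDisperse_false_of_framedAxisPulsesDevelopmentExists (framedAxisPulsesDevelopmentExists_of_rough H)

end Summit.FinalStateConjecture.FinalStateConjecture.Theorems.DrainImpliesDisperse.Negative

end
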